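import Mathlib
import Summits.ValiantsHypothesis.ValiantsHypothesis.Theorems.LacunarySymmetroidMatrixDescartesDefiniteMomentsZonesCorollaries

/-!
# `MatrixDescartes` (stmt-ValiantsHypothesis-18050) — the DEFINITE-MOMENTS LAW, zones XII: the intrinsic hyperbolic sector is
# invariant under congruence and closed under compression

HONEST FRAMING.  Cell `pub-symmetroid`, seat `val-sym-mdr-p2` (gen 15); helper file `--supports` the crux
`Theses.LacunarySymmetroid.MatrixDescartes`, NO closure claim.  Structure of the sector of the lacunary Markus theorem
(`…DefiniteMomentsZones`): nothing here bears on the crux in its window, on `stub_twoSided`, on `DoorA26`/`DoorA34`, registers,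
or `VP ≠ VNP`.

CONTENT (`K` letters `Sₗ`, RAYLEIGH-SHARP = every Rayleigh `K`-nomial `∑ₗ (uᵀSₗu)X^{dₗ}`, `u ≠ 0`, has `≥ K − 1` positive roots).
* `rayleighSharp_congr`: for an invertible real `P`, the congruent letters `Pᵀ Sₗ P` are Rayleigh-sharp (the Rayleigh polynomial
  of `u` is that of `Pu`) — the sector is a `GL`-invariant cone;
* `rayleighSharp_submatrix`: for an injective re-indexing `e : ι' → ι`, the principal sub-letters `Sₗ.submatrix e e` are
  Rayleigh-sharp (the Rayleigh polynomial of `u'` is that of its extension by zero) — the sector is closed under compression,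
  so every principal sub-pencil of a Rayleigh-sharp pencil obeys `Z₊ ≤ (K−1)·(card ι')` (`card_posRoots_submatrix_le`).
[folklore]; axioms standard; no definitions.
-/

-- layout Summits/ValiantsHypothesis/ValiantsHypothesis forces the duplicated namespace component
set_option linter.dupNamespace false

namespace Summit.ValiantsHypothesis.ValiantsHypothesis.Theorems.LacunarySymmetroidMatrixDescartes

open Polynomial Matrix Finset
open scoped BigOperators

namespace DefiniteMoments

section Closure

variable {ι : Type} [Fintype ι]

/-- Rayleigh form of a congruent letter: `uᵀ(PᵀSP)u = (Pu)ᵀS(Pu)`. [folklore] -/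
theorem form_congr (S P : Matrix ι ι ℝ) (u : ι → ℝ) :
    u ⬝ᵥ ((Pᵀ * S * P) *ᵥ u) = (P *ᵥ u) ⬝ᵥ (S *ᵥ (P *ᵥ u)) := by
  rw [← Matrix.mulVec_mulVec, ← Matrix.mulVec_mulVec, Matrix.dotProduct_mulVec, Matrix.vecMul_transpose]

/-- **Congruence invariance.**  If the letters `Sₗ` form a Rayleigh-sharp pencil and `P` is a real matrix with `det P ≠ 0`,
then the letters `Pᵀ Sₗ P` form a Rayleigh-sharp pencil. [folklore] -/
theorem rayleighSharp_congr [DecidableEq ι] {K : ℕ} (d : Fin K → ℕ) (S : Fin K → Matrix ι ι ℝ)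
    (hsharp : ∀ v : ι → ℝ, v ≠ 0 →
      K ≤ ((∑ l, C (v ⬝ᵥ (S l *ᵥ v)) * (X : ℝ[X]) ^ d l).roots.toFinset.filter (fun t => 0 < t)).card + 1)
    (P : Matrix ι ι ℝ) (hP : P.det ≠ 0) (u : ι → ℝ) (hu : u ≠ 0) :
    K ≤ ((∑ l, C (u ⬝ᵥ ((Pᵀ * S l * P) *ᵥ u)) * (X : ℝ[X]) ^ d l).roots.toFinset.filter (fun t => 0 < t)).card + 1 := by
  have hPu : P *ᵥ u ≠ 0 := by
    intro h0
    exact hP (Matrix.exists_mulVec_eq_zero_iff.1 ⟨u, hu, h0⟩)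
  have h := hsharp (P *ᵥ u) hPu
  have e : (∑ l, C (u ⬝ᵥ ((Pᵀ * S l * P) *ᵥ u)) * (X : ℝ[X]) ^ d l)
      = ∑ l, C ((P *ᵥ u) ⬝ᵥ (S l *ᵥ (P *ᵥ u))) * (X : ℝ[X]) ^ d l :=
    Finset.sum_congr rfl fun l _ => by rw [form_congr]
  rw [e]
  exact h

omit [Fintype ι] in
/-- Rayleigh form of a principal sub-letter: for injective `e : ι' → ι`, `u'ᵀ (S.submatrix e e) u' = uᵀ S u` with `u` the
extension of `u'` by zero. [folklore] -/
theorem form_submatrix [Fintype ι] {ι' : Type} [Fintype ι'] [DecidableEq ι] (S : Matrix ι ι ℝ) (e : ι' → ι)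
    (he : Function.Injective e) (u' : ι' → ℝ) :
    u' ⬝ᵥ ((S.submatrix e e) *ᵥ u') = (Function.extend e u' 0) ⬝ᵥ (S *ᵥ (Function.extend e u' 0)) := by
  classical
  set u : ι → ℝ := Function.extend e u' 0 with hu
  have hue : ∀ i', u (e i') = u' i' := fun i' => he.extend_apply _ _ _
  have hu0 : ∀ i, (¬ ∃ i', e i' = i) → u i = 0 := fun i hi => by
    rw [hu, Function.extend_apply' _ _ _ hi, Pi.zero_apply]
  -- a sum over `ι` of a function supported on the image of `e` is the sum over `ι'`
  have hsum : ∀ g : ι → ℝ, (∀ i, (¬ ∃ i', e i' = i) → g i = 0) → ∑ i, g i = ∑ i', g (e i') := by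
    intro g hg
    have h1 : ∑ i', g (e i') = ∑ i ∈ (Finset.univ : Finset ι').map ⟨e, he⟩, g i := by
      rw [Finset.sum_map]; rfl
    rw [h1]
    refine (Finset.sum_subset (Finset.subset_univ _) fun i _ hi => hg i ?_).symm
    rintro ⟨i', rfl⟩
    exact hi (Finset.mem_map.2 ⟨i', Finset.mem_univ _, rfl⟩)
  simp only [dotProduct, Matrix.mulVec, Matrix.submatrix_apply]
  rw [hsum (fun i => u i * ∑ j, S i j * u j) (fun i hi => by rw [hu0 i hi, zero_mul])]
  refine Finset.sum_congr rfl fun i' _ => ?_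
  rw [hue]
  congr 1
  rw [hsum (fun j => S (e i') j * u j) (fun j hj => by rw [hu0 j hj, mul_zero])]
  exact Finset.sum_congr rfl fun j' _ => by rw [hue]

/-- **Closure under compression.**  If the letters `Sₗ` form a Rayleigh-sharp pencil on `ι` and `e : ι' → ι` is injective,
then the principal sub-letters `Sₗ.submatrix e e` form a Rayleigh-sharp pencil on `ι'`. [folklore] -/
theorem rayleighSharp_submatrix {ι' : Type} [Fintype ι'] [DecidableEq ι] {K : ℕ} (d : Fin K → ℕ)
    (S : Fin K → Matrix ι ι ℝ)
    (hsharp : ∀ v : ι → ℝ, v ≠ 0 →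
      K ≤ ((∑ l, C (v ⬝ᵥ (S l *ᵥ v)) * (X : ℝ[X]) ^ d l).roots.toFinset.filter (fun t => 0 < t)).card + 1)
    (e : ι' → ι) (he : Function.Injective e) (u' : ι' → ℝ) (hu' : u' ≠ 0) :
    K ≤ ((∑ l, C (u' ⬝ᵥ ((S l).submatrix e e *ᵥ u')) * (X : ℝ[X]) ^ d l).roots.toFinset.filter
      (fun t => 0 < t)).card + 1 := by
  classical
  set u : ι → ℝ := Function.extend e u' 0 with hu
  have hune : u ≠ 0 := by
    intro h0
    apply hu'
    funext i'
    have h := congrFun h0 (e i')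
    rw [hu, he.extend_apply] at h
    exact h
  have h := hsharp u hune
  have eq : (∑ l, C (u' ⬝ᵥ ((S l).submatrix e e *ᵥ u')) * (X : ℝ[X]) ^ d l)
      = ∑ l, C (u ⬝ᵥ (S l *ᵥ u)) * (X : ℝ[X]) ^ d l :=
    Finset.sum_congr rfl fun l _ => by rw [form_submatrix (S l) e he u']
  rw [eq]
  exact h

/-- **Principal sub-pencils of a Rayleigh-sharp pencil obey the law**: with symmetric letters at strictly increasing exponents,
every principal sub-pencil (injective re-indexing `e : ι' → ι`) has at most `(K − 1)·card ι'` distinct positive determinant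
zeros. [folklore] -/
theorem card_posRoots_submatrix_le {ι' : Type} [Fintype ι'] [DecidableEq ι'] [DecidableEq ι] {K : ℕ} (hK : 2 ≤ K)
    (d : Fin K → ℕ) (hd : StrictMono d) (S : Fin K → Matrix ι ι ℝ) (hS : ∀ l, (S l).IsSymm)
    (hsharp : ∀ v : ι → ℝ, v ≠ 0 →
      K ≤ ((∑ l, C (v ⬝ᵥ (S l *ᵥ v)) * (X : ℝ[X]) ^ d l).roots.toFinset.filter (fun t => 0 < t)).card + 1)
    (e : ι' → ι) (he : Function.Injective e) :
    ((Matrix.det (∑ k, ((X : ℝ[X]) ^ d k) • ((S k).submatrix e e).map C)).roots.toFinset.filter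
        (fun t => 0 < t)).card ≤ (K - 1) * Fintype.card ι' :=
  card_posRoots_le_of_rayleighSharp hK d hd (fun l => (S l).submatrix e e) (fun l => (hS l).submatrix e)
    (rayleighSharp_submatrix d S hsharp e he)

end Closure

end DefiniteMoments

end Summit.ValiantsHypothesis.ValiantsHypothesis.Theorems.LacunarySymmetroidMatrixDescartes
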